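import Mathlib.Analysis.SpecialFunctions.Pow.Real
import Mathlib.Analysis.SpecialFunctions.Pow.Continuity
import Mathlib.Analysis.MeanInequalitiesPow
import Mathlib.Analysis.SpecificLimits.Basic
import HarnessLib

/-!
# The iteration behind Lemarié-Rieusset 2016, Lemma 13.4 (abstract real form)

Analysis/FluidPDE file in the decomposition of the named fact
`Literature.Analysis.FluidPDE.lemarieRieusset_ckn_criterion` (Lemarié-Rieusset 2016, Thm. 13.8),
towards the proof of `LemarieRieusset2016.lemma13_4` (`CKNMorreyLemmas.lean`) from Lemma 13.3
(`CKNMorreyLocalEnergy.lean`). The end of the printed proof of Lemma 13.4 (§13.9, Step 2,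
pp. 473–474) is a statement about nonnegative real sequences: along the scales `κⁿ ρ₀` at the
centre `(t₀, x₀)` the reduced quantities `αₙ` (energy + dissipation) and `qₙ` (pressure) satisfy

* (13.48) `α_{n+1} ≤ ¼ αₙ + uₙ αₙ + C_κ qₙ^{1/q₀} αₙ^{1/2} + vₙ αₙ^{1/2}`,
* (13.49) `q_{n+1} ≤ ¼ qₙ + wₙ αₙ^{q₀/2}`,

"where `uₙ`, `vₙ` and `wₙ` go to `0` when `n` goes to `+∞`", and the book concludes
`lim αₙ = lim qₙ = 0` through `θₙ = αₙ + D qₙ^{2/q₀}` with `D` large (p. 473: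
`θ_{n+1} ≤ Γ θₙ + Xₙ θₙ + Yₙ`, `Γ < 1`, `Xₙ, Yₙ → 0`).

This file **proves** that implication (`LemarieRieusset2016.iteration_tendsto_zero`), in the
slightly stronger form that the Navier–Stokes assembly actually needs: in the printed setting
`uₙ = C_κ β_{κⁿρ₀}^{1/2}` and `wₙ = C_κ β_{κⁿρ₀}^{q₀/2}` with `βᵣ = r⁻¹ V_r(t₀, x₀)`, and the
hypothesis of Lemma 13.4 / Thm. 13.8 is `limsup_{r → 0} βᵣ < ε*` (not `βᵣ → 0`, although p. 473
says "the assumption that `lim_{r → 0} β_r(t₀, x₀) = 0`"); accordingly it suffices that `uₙ` and `wₙ`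
are *eventually below a threshold `δ₀ > 0` depending only on `q₀` and `C_κ`*, while `vₙ → 0`
(`vₙ = C_κ (κⁿρ₀)^{2 - 5/τ₀ + 5/τ₂} ‖1_{Q₀} f‖_{ℳ₂^{10/7,τ₀}}` does tend to `0`). The threshold is
what makes `ε*` depend on `(ν, q₀, τ₀, τ₂)` only.

* `tendsto_zero_of_eventually_le_mul_add` — `θ_{n+1} ≤ γ θₙ + Yₙ` eventually, `0 ≤ γ < 1`,
  `Yₙ → 0`, `θ ≥ 0` imply `θₙ → 0`.
* `iteration_tendsto_zero` — the scheme (13.48)–(13.49) ⟹ `αₙ → 0` and `qₙ → 0`, for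
  `1 ≤ q₀ ≤ 2` (in print `1 < q₀ ≤ 3/2`), with `D = 16 (C_κ + 1)²`, `Γ = 13/16`.
* `invariant_region` — the `β`-free recursions (13.45)–(13.47) keep `αₙ ≤ 1`, `qₙ ≤ c_*` and
  give `pₙ ≤ p₀ + (4/3) C_κ` down the scales once `α₀ ≤ 1`, `q₀ ≤ c_*` (p. 473).

Nothing here is specific to Navier–Stokes; compare the abstract decay scheme of the
Caffarelli–Kohn–Nirenberg 1982 route (`CKNDecayScheme.lean`).

## References

* P. G. Lemarié-Rieusset, *The Navier–Stokes Problem in the 21st Century*, CRC Press (2016),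
  §13.9, Step 2, (13.45)–(13.49) and the `θₙ` argument, pp. 472–474. [LemarieRieusset2016]
-/

namespace Literature.Analysis.FluidPDE

namespace LemarieRieusset2016

open Filter Topology

/-- **A contracting recursion with vanishing forcing tends to zero**: if `θₙ ≥ 0`,
`θ_{n+1} ≤ γ θₙ + Yₙ` for all large `n` with `0 ≤ γ < 1`, and `Yₙ → 0`, then `θₙ → 0`
(Lemarié-Rieusset 2016, p. 473: "`θ_{n+1} ≤ Γ θₙ + Xₙ θₙ + Yₙ` … if `Γ < 1` … `lim θₙ = 0`"). [folklore] -/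
theorem tendsto_zero_of_eventually_le_mul_add {θ Y : ℕ → ℝ} {γ : ℝ} (hγ0 : 0 ≤ γ) (hγ1 : γ < 1)
    (hθ : ∀ n, 0 ≤ θ n) (h : ∀ᶠ n in atTop, θ (n + 1) ≤ γ * θ n + Y n)
    (hY : Tendsto Y atTop (𝓝 0)) : Tendsto θ atTop (𝓝 0) := by
  rw [Metric.tendsto_atTop]
  intro ε hε
  have hε' : 0 < (1 - γ) * ε / 2 := by nlinarith
  obtain ⟨N₁, hN₁⟩ := eventually_atTop.1 h
  obtain ⟨N₂, hN₂⟩ := Metric.tendsto_atTop.1 hY ((1 - γ) * ε / 2) hε'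
  set N := max N₁ N₂ with hN
  -- along `N + k` the recursion is dominated by a geometric sequence plus `ε / 2`
  have key : ∀ k, θ (N + k) ≤ γ ^ k * θ N + ε / 2 := by
    intro k
    induction k with
    | zero => simp only [add_zero, pow_zero, one_mul]; linarith
    | succ k ih =>
      have h1 := hN₁ (N + k) (le_trans (le_max_left _ _) (Nat.le_add_right _ _))
      have h2 := hN₂ (N + k) (le_trans (le_max_right _ _) (Nat.le_add_right _ _))
      rw [Real.dist_eq, sub_zero] at h2
      have h2' : Y (N + k) ≤ (1 - γ) * ε / 2 := (le_abs_self _).trans h2.le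
      show θ (N + k + 1) ≤ γ ^ (k + 1) * θ N + ε / 2
      calc θ (N + k + 1) ≤ γ * θ (N + k) + Y (N + k) := h1
        _ ≤ γ * (γ ^ k * θ N + ε / 2) + (1 - γ) * ε / 2 := by gcongr
        _ = γ ^ (k + 1) * θ N + ε / 2 := by ring
  have hg : Tendsto (fun k => γ ^ k * θ N) atTop (𝓝 0) := by
    simpa using (tendsto_pow_atTop_nhds_zero_of_lt_one hγ0 hγ1).mul_const (θ N)
  obtain ⟨K, hK⟩ := Metric.tendsto_atTop.1 hg (ε / 2) (by linarith)
  refine ⟨N + K, fun n hn => ?_⟩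
  obtain ⟨k, rfl⟩ : ∃ k, n = N + k := ⟨n - N, by omega⟩
  have h3 := hK k (by omega)
  rw [Real.dist_eq, sub_zero] at h3 ⊢
  rw [abs_of_nonneg (hθ _)]
  have h4 : γ ^ k * θ N < ε / 2 := (le_abs_self _).trans_lt h3
  linarith [key k]

/-- Two-point convexity of `x ↦ x^s`, `s ≥ 1`, on `[0, ∞)`: `(a + b)^s ≤ 2^{s-1} (a^s + b^s)`
(real-valued form of Mathlib's `NNReal.rpow_add_le_mul_rpow_add_rpow`). [folklore] -/
theorem add_rpow_le_two_rpow_mul {a b s : ℝ} (ha : 0 ≤ a) (hb : 0 ≤ b) (hs : 1 ≤ s) :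
    (a + b) ^ s ≤ (2 : ℝ) ^ (s - 1) * (a ^ s + b ^ s) := by
  lift a to NNReal using ha
  lift b to NNReal using hb
  have := NNReal.rpow_add_le_mul_rpow_add_rpow a b hs
  have h' : ((a + b : NNReal) : ℝ) ^ s ≤ (((2 : NNReal) ^ (s - 1) * (a ^ s + b ^ s) : NNReal) : ℝ) := by
    exact_mod_cast this
  simpa [NNReal.coe_rpow] using h'

/-- **The iteration of Lemarié-Rieusset 2016, Step 2, in abstract form** ((13.48)–(13.49) ⟹
`αₙ, qₙ → 0`, pp. 473–474). Let `1 ≤ q₀ ≤ 2` and `C_κ ≥ 0`. There is `δ₀ = δ₀(q₀, C_κ) > 0` such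
that for all nonnegative real sequences `α, q, u, v, w` with
`α_{n+1} ≤ ¼ αₙ + uₙ αₙ + C_κ qₙ^{1/q₀} αₙ^{1/2} + vₙ αₙ^{1/2}` and `q_{n+1} ≤ ¼ qₙ + wₙ αₙ^{q₀/2}` for
all `n`, if `uₙ ≤ δ₀` and `wₙ ≤ δ₀` for all large `n` and `vₙ → 0`, then `αₙ → 0` and `qₙ → 0`.
Proof as printed with explicit constants: `θₙ = αₙ + D qₙ^{2/q₀}`, `D = 16 (C_κ + 1)²`, so that
`C_κ qₙ^{1/q₀} αₙ^{1/2} ≤ θₙ/8`, `vₙ αₙ^{1/2} ≤ vₙ θₙ + vₙ/4`,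
`D q_{n+1}^{2/q₀} ≤ ¼ D qₙ^{2/q₀} + 2 D wₙ^{2/q₀} αₙ` (two-point convexity, `(q₀/2)(2/q₀) = 1`), whence
`θ_{n+1} ≤ (5/8 + uₙ + vₙ + 2D wₙ^{2/q₀}) θₙ + vₙ/4 ≤ (13/16) θₙ + vₙ/4` eventually. [cite: LemarieRieusset2016, §13.9 Step 2 (13.48)–(13.49) pp. 473–474] -/
theorem iteration_tendsto_zero {q₀ Cκ : ℝ} (hq₀ : 1 ≤ q₀) (hq₀2 : q₀ ≤ 2) (hC : 0 ≤ Cκ) :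
    ∃ δ₀ : ℝ, 0 < δ₀ ∧ ∀ (α q u v w : ℕ → ℝ),
      (∀ n, 0 ≤ α n) → (∀ n, 0 ≤ q n) → (∀ n, 0 ≤ u n) → (∀ n, 0 ≤ v n) → (∀ n, 0 ≤ w n) →
      (∀ n, α (n + 1) ≤ α n / 4 + u n * α n + Cκ * q n ^ (1 / q₀) * α n ^ (1 / 2 : ℝ) +
        v n * α n ^ (1 / 2 : ℝ)) →
      (∀ n, q (n + 1) ≤ q n / 4 + w n * α n ^ (q₀ / 2)) →
      (∀ᶠ n in atTop, u n ≤ δ₀) → (∀ᶠ n in atTop, w n ≤ δ₀) → Tendsto v atTop (𝓝 0) →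
      Tendsto α atTop (𝓝 0) ∧ Tendsto q atTop (𝓝 0) := by
  -- constants
  set s : ℝ := 2 / q₀ with hs
  have hq₀0 : 0 < q₀ := by linarith
  have hs1 : 1 ≤ s := by rw [hs, le_div_iff₀ hq₀0]; linarith
  have hs2 : s ≤ 2 := by rw [hs, div_le_iff₀ hq₀0]; linarith
  have hs0 : 0 < s := by linarith
  have hsq : q₀ / 2 * s = 1 := by rw [hs]; field_simp
  have hsq' : 1 / q₀ = s * (1 / 2) := by rw [hs]; ring
  set E : ℝ := 4 * (Cκ + 1) with hE
  set D : ℝ := E ^ 2 with hD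
  have hE0 : 0 < E := by rw [hE]; linarith
  have hD0 : 0 < D := by positivity
  have hCE : Cκ / E ≤ 1 / 4 := by
    rw [div_le_iff₀ hE0, hE]; linarith
  set δ₀ : ℝ := min (1 / 16) (1 / (32 * D)) with hδ₀
  have hδ₀0 : 0 < δ₀ := lt_min (by norm_num) (by positivity)
  have hδ₀1 : δ₀ ≤ 1 / 16 := min_le_left _ _
  have hδ₀2 : δ₀ ≤ 1 / (32 * D) := min_le_right _ _
  have hδ₀one : δ₀ ≤ 1 := hδ₀1.trans (by norm_num)
  refine ⟨δ₀, hδ₀0, ?_⟩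
  intro α q u v w hα hq hu hv hw h48 h49 hu' hw' hv'
  -- the Lyapunov quantity `θ n = α n + D (q n)^s`
  set θ : ℕ → ℝ := fun n => α n + D * q n ^ s with hθ
  have hθq : ∀ n, 0 ≤ D * q n ^ s := fun n => mul_nonneg hD0.le (Real.rpow_nonneg (hq n) _)
  have hθ0 : ∀ n, 0 ≤ θ n := fun n => add_nonneg (hα n) (hθq n)
  have hαθ : ∀ n, α n ≤ θ n := fun n => le_add_of_nonneg_right (hθq n)
  have hqθ : ∀ n, D * q n ^ s ≤ θ n := fun n => le_add_of_nonneg_left (hα n)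
  -- one step of the recursion for `θ`
  have step : ∀ n, θ (n + 1) ≤ (5 / 8 + u n + v n + 2 * D * w n ^ s) * θ n + v n / 4 := by
    intro n
    have hαn := hα n
    have hqn := hq n
    -- the square root of `α n`
    set a : ℝ := α n ^ (1 / 2 : ℝ) with ha
    have ha0 : 0 ≤ a := Real.rpow_nonneg hαn _
    have ha2 : a ^ 2 = α n := by
      rw [ha, ← Real.rpow_natCast, ← Real.rpow_mul hαn]; norm_num
    -- `b = E q^{1/q₀}` with `b² = D q^s`
    set b : ℝ := E * q n ^ (1 / q₀) with hb
    have hb0 : 0 ≤ b := mul_nonneg hE0.le (Real.rpow_nonneg hqn _)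
    have hb2 : b ^ 2 = D * q n ^ s := by
      have h1 : (q n ^ (1 / q₀)) ^ 2 = q n ^ s := by
        rw [← Real.rpow_natCast, ← Real.rpow_mul hqn, hs]
        congr 1
        push_cast
        ring
      rw [hb, mul_pow, hD, h1]
    -- the pressure–energy cross term: `Cκ q^{1/q₀} α^{1/2} ≤ θ / 8`
    have hcross : Cκ * q n ^ (1 / q₀) * α n ^ (1 / 2 : ℝ) ≤ θ n / 8 := by
      have h1 : Cκ * q n ^ (1 / q₀) * α n ^ (1 / 2 : ℝ) = Cκ / E * (a * b) := by
        rw [hb, ha, div_mul_eq_mul_div, eq_div_iff hE0.ne']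
        ring
      have h2 : a * b ≤ (a ^ 2 + b ^ 2) / 2 := by nlinarith [sq_nonneg (a - b)]
      have h3 : a ^ 2 + b ^ 2 = θ n := by rw [ha2, hb2]
      rw [h1]
      calc Cκ / E * (a * b) ≤ 1 / 4 * ((a ^ 2 + b ^ 2) / 2) :=
            mul_le_mul hCE h2 (mul_nonneg ha0 hb0) (by norm_num)
        _ = θ n / 8 := by rw [h3]; ring
    -- the force term: `v α^{1/2} ≤ v θ + v / 4`
    have hforce : v n * α n ^ (1 / 2 : ℝ) ≤ v n * θ n + v n / 4 := by
      have h1 : a ≤ a ^ 2 + 1 / 4 := by nlinarith [sq_nonneg (a - 1 / 2)]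
      calc v n * a ≤ v n * (a ^ 2 + 1 / 4) := mul_le_mul_of_nonneg_left h1 (hv n)
        _ ≤ v n * (θ n + 1 / 4) := by rw [ha2]; gcongr; exacts [hv n, hαθ n]
        _ = v n * θ n + v n / 4 := by ring
    -- the velocity recursion in terms of `θ`
    have hA : α (n + 1) ≤ (3 / 8 + u n + v n) * θ n + v n / 4 := by
      have := h48 n
      have h2 : u n * α n ≤ u n * θ n := mul_le_mul_of_nonneg_left (hαθ n) (hu n)
      nlinarith [hαθ n, hcross, hforce, hθ0 n]
    -- the pressure recursion in terms of `θ`: `D q_{n+1}^s ≤ ¼ D q^s + 2 D w^s α`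
    have hB : D * q (n + 1) ^ s ≤ 1 / 4 * (D * q n ^ s) + 2 * D * w n ^ s * α n := by
      have hq1 : 0 ≤ q (n + 1) := hq (n + 1)
      have hwa : 0 ≤ w n * α n ^ (q₀ / 2) := mul_nonneg (hw n) (Real.rpow_nonneg hαn _)
      have h1 : q (n + 1) ^ s ≤ (q n / 4 + w n * α n ^ (q₀ / 2)) ^ s :=
        Real.rpow_le_rpow hq1 (h49 n) hs0.le
      have h2 := add_rpow_le_two_rpow_mul (by positivity : 0 ≤ q n / 4) hwa hs1
      -- `2^{s-1} (q/4)^s ≤ q^s / 4`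
      have h3 : (2 : ℝ) ^ (s - 1) * (q n / 4) ^ s ≤ q n ^ s / 4 := by
        have h4s : (4 : ℝ) ^ s = 2 ^ (2 * s) := by
          rw [show (4 : ℝ) = 2 ^ (2 : ℝ) by norm_num, ← Real.rpow_mul (by norm_num)]
        rw [Real.div_rpow hqn (by norm_num), h4s]
        have h4 : (2 : ℝ) ^ (s - 1) / 2 ^ (2 * s) ≤ 1 / 4 := by
          rw [← Real.rpow_sub (by norm_num)]
          calc (2 : ℝ) ^ (s - 1 - 2 * s) ≤ 2 ^ (-2 : ℝ) :=
                Real.rpow_le_rpow_of_exponent_le (by norm_num) (by linarith)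
            _ = 1 / 4 := by rw [Real.rpow_neg (by norm_num)]; norm_num
        calc (2 : ℝ) ^ (s - 1) * (q n ^ s / 2 ^ (2 * s)) = 2 ^ (s - 1) / 2 ^ (2 * s) * q n ^ s := by
              ring
          _ ≤ 1 / 4 * q n ^ s :=
              mul_le_mul_of_nonneg_right h4 (Real.rpow_nonneg hqn _)
          _ = q n ^ s / 4 := by ring
      -- `2^{s-1} (w α^{q₀/2})^s ≤ 2 w^s α`
      have h5 : (2 : ℝ) ^ (s - 1) * (w n * α n ^ (q₀ / 2)) ^ s ≤ 2 * (w n ^ s * α n) := by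
        rw [Real.mul_rpow (hw n) (Real.rpow_nonneg hαn _), ← Real.rpow_mul hαn, hsq,
          Real.rpow_one]
        have h6 : (2 : ℝ) ^ (s - 1) ≤ 2 := by
          calc (2 : ℝ) ^ (s - 1) ≤ 2 ^ (1 : ℝ) :=
                Real.rpow_le_rpow_of_exponent_le (by norm_num) (by linarith)
            _ = 2 := Real.rpow_one 2
        exact mul_le_mul_of_nonneg_right h6 (mul_nonneg (Real.rpow_nonneg (hw n) _) hαn)
      calc D * q (n + 1) ^ s ≤ D * ((q n / 4 + w n * α n ^ (q₀ / 2)) ^ s) :=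
            mul_le_mul_of_nonneg_left h1 hD0.le
        _ ≤ D * ((2 : ℝ) ^ (s - 1) * ((q n / 4) ^ s + (w n * α n ^ (q₀ / 2)) ^ s)) :=
            mul_le_mul_of_nonneg_left h2 hD0.le
        _ = D * ((2 : ℝ) ^ (s - 1) * (q n / 4) ^ s) +
              D * ((2 : ℝ) ^ (s - 1) * (w n * α n ^ (q₀ / 2)) ^ s) := by ring
        _ ≤ D * (q n ^ s / 4) + D * (2 * (w n ^ s * α n)) := by gcongr
        _ = 1 / 4 * (D * q n ^ s) + 2 * D * w n ^ s * α n := by ring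
    -- add up
    have hwα : 2 * D * w n ^ s * α n ≤ 2 * D * w n ^ s * θ n :=
      mul_le_mul_of_nonneg_left (hαθ n)
        (mul_nonneg (mul_nonneg (by norm_num) hD0.le) (Real.rpow_nonneg (hw n) _))
    calc θ (n + 1) = α (n + 1) + D * q (n + 1) ^ s := rfl
      _ ≤ (3 / 8 + u n + v n) * θ n + v n / 4 + (1 / 4 * (D * q n ^ s) + 2 * D * w n ^ s * α n) :=
          add_le_add hA hB
      _ ≤ (3 / 8 + u n + v n) * θ n + v n / 4 + (1 / 4 * θ n + 2 * D * w n ^ s * θ n) := by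
          gcongr
          · exact hqθ n
      _ = (5 / 8 + u n + v n + 2 * D * w n ^ s) * θ n + v n / 4 := by ring
  -- eventually the coefficient is at most `13/16`
  have hv16 : ∀ᶠ n in atTop, v n ≤ 1 / 16 := by
    have := Metric.tendsto_atTop.1 hv' (1 / 16) (by norm_num)
    obtain ⟨N, hN⟩ := this
    refine eventually_atTop.2 ⟨N, fun n hn => ?_⟩
    have := hN n hn
    rw [Real.dist_eq, sub_zero] at this
    exact (le_abs_self _).trans this.le
  have hrec : ∀ᶠ n in atTop, θ (n + 1) ≤ 13 / 16 * θ n + v n / 4 := by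
    filter_upwards [hu', hw', hv16] with n hun hwn hvn
    have hws : 2 * D * w n ^ s ≤ 1 / 16 := by
      have hw1 : w n ≤ 1 := hwn.trans hδ₀one
      have hws1 : w n ^ s ≤ w n := by
        calc w n ^ s ≤ w n ^ (1 : ℝ) :=
              Real.rpow_le_rpow_of_exponent_ge' (hw n) hw1 (by norm_num) hs1
          _ = w n := Real.rpow_one _
      have hw2 : w n ≤ 1 / (32 * D) := hwn.trans hδ₀2
      calc 2 * D * w n ^ s ≤ 2 * D * (1 / (32 * D)) := by
            exact mul_le_mul_of_nonneg_left (hws1.trans hw2) (by positivity)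
        _ = 1 / 16 := by field_simp; ring
    have hun' : u n ≤ 1 / 16 := hun.trans hδ₀1
    calc θ (n + 1) ≤ (5 / 8 + u n + v n + 2 * D * w n ^ s) * θ n + v n / 4 := step n
      _ ≤ 13 / 16 * θ n + v n / 4 := by
          have : 5 / 8 + u n + v n + 2 * D * w n ^ s ≤ 13 / 16 := by linarith
          nlinarith [hθ0 n]
  have hθlim : Tendsto θ atTop (𝓝 0) :=
    tendsto_zero_of_eventually_le_mul_add (by norm_num) (by norm_num) hθ0 hrec
      (by simpa using hv'.div_const 4)
  -- squeeze `α` and `q`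
  have hαlim : Tendsto α atTop (𝓝 0) :=
    tendsto_of_tendsto_of_tendsto_of_le_of_le tendsto_const_nhds hθlim hα hαθ
  have hqs : Tendsto (fun n => q n ^ s) atTop (𝓝 0) := by
    have h1 : Tendsto (fun n => θ n / D) atTop (𝓝 0) := by simpa using hθlim.div_const D
    refine tendsto_of_tendsto_of_tendsto_of_le_of_le tendsto_const_nhds h1
      (fun n => Real.rpow_nonneg (hq n) _) fun n => ?_
    rw [le_div_iff₀ hD0, mul_comm]
    exact hqθ n
  have hqlim : Tendsto q atTop (𝓝 0) := by
    have h1 := hqs.rpow_const (p := 1 / s) (Or.inr (by positivity))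
    rw [Real.zero_rpow (by positivity)] at h1
    refine h1.congr fun n => ?_
    rw [← Real.rpow_mul (hq n), mul_one_div_cancel hs0.ne', Real.rpow_one]
  exact ⟨hαlim, hqlim⟩

/-- **The invariant region of Lemarié-Rieusset 2016, Step 2** ((13.45)–(13.47) ⟹ "then the same
will be true for `κρ`, and by induction for all `κⁿρ`… moreover `p_{κⁿr₁} ≤ p_{r₁} + (4/3) C_κ`",
p. 473), in abstract real form. Along scales `ρₙ ∈ (0, ρ₀]` let nonnegative reals `αₙ, qₙ, pₙ`
satisfy the `β`-free recursions
`α_{n+1} ≤ ¼ αₙ + A₁ ρₙ^{e₁} αₙ^{3/2} + C_κ qₙ^{1/q₀} αₙ^{1/2} + A₂ ρₙ^{γ} αₙ^{1/2}` (13.45),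
`q_{n+1} ≤ ¼ qₙ + A₃ ρₙ^{e₂} αₙ^{m}` (13.46, any fixed power `m > 0` of `αₙ`) and
`p_{n+1} ≤ ¼ pₙ + C_κ αₙ^{q₀}` (13.47), with `e₁, e₂, γ ≥ 0` and `ρ₀` so small that
`A₁ ρ₀^{e₁} ≤ ¼`, `A₂ ρ₀^{γ} ≤ ¼` and `A₃ ρ₀^{e₂} ≤ ¾ c_*`, where `c_* = (4 (C_κ + 1))^{-q₀}` (so that
`C_κ c_*^{1/q₀} ≤ ¼`; the book's `(1/(4C_κ))^{q₀}`). If `α₀ ≤ 1` and `q₀' := q 0 ≤ c_*`, then for all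
`n`: `αₙ ≤ 1`, `qₙ ≤ c_*` and `pₙ ≤ p₀ + (4/3) C_κ`. [cite: LemarieRieusset2016, §13.9 Step 2 (13.45)–(13.47) p. 473] -/
theorem invariant_region {q₀ Cκ A₁ A₂ A₃ e₁ e₂ γ m ρ₀ : ℝ} (hq₀ : 0 < q₀) (hC : 0 ≤ Cκ)
    (hA₁ : 0 ≤ A₁) (hA₂ : 0 ≤ A₂) (hA₃ : 0 ≤ A₃) (he₁ : 0 ≤ e₁) (he₂ : 0 ≤ e₂) (hγ : 0 ≤ γ)
    (hm : 0 < m) (h₁ : A₁ * ρ₀ ^ e₁ ≤ 1 / 4) (h₂ : A₂ * ρ₀ ^ γ ≤ 1 / 4)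
    (h₃ : A₃ * ρ₀ ^ e₂ ≤ 3 / 4 * (4 * (Cκ + 1)) ^ (-q₀))
    {ρ α q p : ℕ → ℝ} (hρ0 : ∀ n, 0 < ρ n) (hρle : ∀ n, ρ n ≤ ρ₀) (hα0 : ∀ n, 0 ≤ α n)
    (hq0 : ∀ n, 0 ≤ q n) (hp0 : ∀ n, 0 ≤ p n)
    (hα : ∀ n, α (n + 1) ≤ α n / 4 + A₁ * ρ n ^ e₁ * α n ^ (3 / 2 : ℝ) +
      Cκ * q n ^ (1 / q₀) * α n ^ (1 / 2 : ℝ) + A₂ * ρ n ^ γ * α n ^ (1 / 2 : ℝ))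
    (hq : ∀ n, q (n + 1) ≤ q n / 4 + A₃ * ρ n ^ e₂ * α n ^ m)
    (hp : ∀ n, p (n + 1) ≤ p n / 4 + Cκ * α n ^ q₀)
    (hstart : α 0 ≤ 1) (hstart' : q 0 ≤ (4 * (Cκ + 1)) ^ (-q₀)) :
    ∀ n, α n ≤ 1 ∧ q n ≤ (4 * (Cκ + 1)) ^ (-q₀) ∧ p n ≤ p 0 + 4 / 3 * Cκ := by
  set c : ℝ := (4 * (Cκ + 1)) ^ (-q₀) with hc
  have hK0 : 0 < 4 * (Cκ + 1) := by linarith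
  have hc0 : 0 < c := Real.rpow_pos_of_pos hK0 _
  -- `Cκ c^{1/q₀} ≤ 1/4`
  have hcroot : c ^ (1 / q₀) = (4 * (Cκ + 1))⁻¹ := by
    rw [hc, ← Real.rpow_mul hK0.le, neg_mul, mul_one_div_cancel hq₀.ne', Real.rpow_neg hK0.le,
      Real.rpow_one]
  have hCc : Cκ * c ^ (1 / q₀) ≤ 1 / 4 := by
    rw [hcroot, ← div_eq_mul_inv, div_le_iff₀ hK0]
    linarith
  -- the small factors along the scales
  have hρpow : ∀ n {e : ℝ}, 0 ≤ e → ρ n ^ e ≤ ρ₀ ^ e := fun n e he =>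
    Real.rpow_le_rpow (hρ0 n).le (hρle n) he
  have hf₁ : ∀ n, A₁ * ρ n ^ e₁ ≤ 1 / 4 := fun n =>
    (mul_le_mul_of_nonneg_left (hρpow n he₁) hA₁).trans h₁
  have hf₂ : ∀ n, A₂ * ρ n ^ γ ≤ 1 / 4 := fun n =>
    (mul_le_mul_of_nonneg_left (hρpow n hγ) hA₂).trans h₂
  have hf₃ : ∀ n, A₃ * ρ n ^ e₂ ≤ 3 / 4 * c := fun n =>
    (mul_le_mul_of_nonneg_left (hρpow n he₂) hA₃).trans h₃
  -- powers of `α ∈ [0, 1]` are at most `1`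
  have hpow1 : ∀ {x e : ℝ}, 0 ≤ x → x ≤ 1 → 0 ≤ e → x ^ e ≤ 1 := fun hx hx1 he =>
    Real.rpow_le_one hx hx1 he
  intro n
  induction n with
  | zero => exact ⟨hstart, hstart', by linarith⟩
  | succ n ih =>
    obtain ⟨ihα, ihq, ihp⟩ := ih
    have hαn := hα0 n
    have h32 : α n ^ (3 / 2 : ℝ) ≤ 1 := hpow1 hαn ihα (by norm_num)
    have h12 : α n ^ (1 / 2 : ℝ) ≤ 1 := hpow1 hαn ihα (by norm_num)
    have hmq : α n ^ m ≤ 1 := hpow1 hαn ihα hm.le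
    have hq₀pow : α n ^ q₀ ≤ 1 := hpow1 hαn ihα hq₀.le
    have hqroot : q n ^ (1 / q₀) ≤ c ^ (1 / q₀) :=
      Real.rpow_le_rpow (hq0 n) ihq (by positivity)
    refine ⟨?_, ?_, ?_⟩
    · -- `α_{n+1} ≤ ¼ + ¼ + ¼ + ¼`
      have t1 : A₁ * ρ n ^ e₁ * α n ^ (3 / 2 : ℝ) ≤ 1 / 4 := by
        calc A₁ * ρ n ^ e₁ * α n ^ (3 / 2 : ℝ) ≤ A₁ * ρ n ^ e₁ * 1 := by
              gcongr
              exact mul_nonneg hA₁ (Real.rpow_nonneg (hρ0 n).le _)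
          _ ≤ 1 / 4 := by rw [mul_one]; exact hf₁ n
      have t2 : Cκ * q n ^ (1 / q₀) * α n ^ (1 / 2 : ℝ) ≤ 1 / 4 := by
        calc Cκ * q n ^ (1 / q₀) * α n ^ (1 / 2 : ℝ) ≤ Cκ * c ^ (1 / q₀) * 1 :=
              mul_le_mul (mul_le_mul_of_nonneg_left hqroot hC) h12 (Real.rpow_nonneg hαn _)
                (mul_nonneg hC (Real.rpow_nonneg hc0.le _))
          _ ≤ 1 / 4 := by rw [mul_one]; exact hCc
      have t3 : A₂ * ρ n ^ γ * α n ^ (1 / 2 : ℝ) ≤ 1 / 4 := by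
        calc A₂ * ρ n ^ γ * α n ^ (1 / 2 : ℝ) ≤ A₂ * ρ n ^ γ * 1 := by
              gcongr
              exact mul_nonneg hA₂ (Real.rpow_nonneg (hρ0 n).le _)
          _ ≤ 1 / 4 := by rw [mul_one]; exact hf₂ n
      linarith [hα n]
    · -- `q_{n+1} ≤ ¼ c + ¾ c`
      have t4 : A₃ * ρ n ^ e₂ * α n ^ m ≤ 3 / 4 * c := by
        calc A₃ * ρ n ^ e₂ * α n ^ m ≤ A₃ * ρ n ^ e₂ * 1 := by
              gcongr
              exact mul_nonneg hA₃ (Real.rpow_nonneg (hρ0 n).le _)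
          _ ≤ 3 / 4 * c := by rw [mul_one]; exact hf₃ n
      linarith [hq n]
    · -- `p_{n+1} ≤ ¼ (p₀ + (4/3) Cκ) + Cκ ≤ p₀ + (4/3) Cκ`
      have t5 : Cκ * α n ^ q₀ ≤ Cκ := by
        simpa using mul_le_mul_of_nonneg_left hq₀pow hC
      have := hp n
      nlinarith [hp0 0]

end LemarieRieusset2016

end Literature.Analysis.FluidPDE
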